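import Mathlib
import HarnessLib
import HarnessLib.Audit
import Summits.CriticalPhenomena.Statement
import Summits.CriticalPhenomena.Ising3DConformalLimit.Theorems.HyperoctahedralRPExistsScaleCovariantLimitSplitGlue
import HarnessLib.Audit.Status.Attr

/-!
Route: HarmonicMomentsIsotropy

DORMANT since 2026-08-29T19:30:12Z (census g0: costume|duplicate of route-CriticalPhenomena-HyperoctahedralRP; reader census-reader-35-g0) — unstaffed, not closed; items shared with open routes are served there. `ledger route dormant <id> --off` reactivates.

# Route HarmonicMomentsIsotropy — harmonic moments are unsourced along the beta-flow, so Z^3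
anisotropy is diluted; isotropy of the critical two-point function from an angular hierarchy plus a
xi_2-window

It suffices to show X_HM = (AH) ∧ (CLW) ∧ (RU) ∧ (EX) ∧ (INV) ∧ (U4), realising idea card
harmonic-moments-isotropy
("harmonic polynomials see through convolutions"). Write G_β(x) = ⟨σ₀σ_x⟩_β (free = plus state, β <
β_c) for the n.n. Ising model on ℤ³,
k_(Y,m)(β) = Σ_x Y(x)|x|^(2m) G_β(x) for a harmonic homogeneous polynomial Y of degree n ≥ 1, M_q(β)
= Σ_x |x|^q G_β(x), q = n+2m, and
a_(Y,m) = k_(Y,m)/M_q (the CPRV anisotropy ratios; a = 0 identically unless Y has a cubic-invariant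
part, degrees 4, 6, 8, …).
(AH) ANGULAR HIERARCHY [rank 2, the d = 3 engine]: inductively in q, the β-increments of k_(Y,m) are
contracted relative to those of M_q:
∃θ<1 ∀ε ∃β₀ ∀β₀≤β₁<β₂<β_c, |k(β₂)−k(β₁)| ≤ (θ·sup_[β₁,β₂]|a| + ε)·(M_q(β₂)−M_q(β₁)).
(CLW) ξ₂-WINDOW [rank 3], ξ₂(β)² := M₂/χ: (i) G_β ≥ (1−ε)G_(β_c) inside √s·ξ₂, (ii) Σ_(|x|>Aξ₂) G_β
≤ Ce^(−cA)χ(β).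
(RU) n-POINT ROTATION UPGRADE [rank 4]: vague asymptotic isotropy of ⟨σ₀σ_x⟩_(β_c) ⇒ every
normalised non-degenerate
translation-invariant scale-covariant pointwise scaling limit of criticalCorr 3 is O(3)-invariant.
(EX), (INV), (U4) [ranks 5–7] are the shared complements of route HyperoctahedralRP /
IsingEuclidUpgrade (items 1981, 1982, 0636, same
Lean text): existence of a translation-invariant scale-covariant limit (no rotation clause —
isotropy is OUTPUT here), the NonCoincident-normalised
inversion upgrade, and U₄ ≢ 0. Supports: HierarchyClosure (AH ⇒ all a_(Y,m)(β) → 0, an ODE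
comparison), DilutionTransfer (dilution + CLW + EX ⇒
TwoPointAsymptoticIsotropy, a Carleman/scaled-measure argument), and the two milestones
HarmonicDilution, TwoPointAsymptoticIsotropy filed standalone.
Lean: `AngularHierarchy ∧ CorrelationLengthWindow ∧ RotationUpgrade ∧ ExistsScaleCovariantLimit ∧
InversionUpgradeNormalised ∧ IsingEuclidUpgradeR4NonGaussian`

## Assembly
Pure logic (sorry-free in the planner's Sketch.lean, theorem assembly_holds, 10 lines):
HarmonicDilution := HierarchyClosure AH; ISO :=
DilutionTransfer HarmonicDilution CLW EX; take (ρ, Δ, S) with its five properties from EX;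
RotationUpgrade ISO gives IsRotationInvariant S, so
IsEuclideanInvariant S := ⟨translation, rotation⟩; InversionUpgradeNormalised gives
IsInversionCovariant Δ S; IsMoebiusCovariant Δ S :=
⟨Euclid, scale, inversion⟩ (ConformalCovariance.lean); IsingEuclidUpgradeR4NonGaussian gives
HasNontrivialU4 S; conclude
CritIsing3DConformalLimit = Ising3DConformalLimit (root abbrev of
Summits/CriticalPhenomena/Ising3DConformalLimit/Statement.lean).

Rationale: WHY THIS LINE. Clause (ii) of Ising3DConformalLimit contains O(3); on ℤ³ rotation invariance of the
critical limit is only postulated (DuminilCopinICM2022 §8.1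
p.25) and the proved engines are planar (arXiv:2012.11672) or perturbative (d > 4 lace expansion,
Sakai2007/Hara2008). The card's mechanism is
elementary harmonic analysis on ℤ³ transplanted into correlation-inequality technology: for
cubic-symmetric kernels the harmonic moments are
UNSOURCED under convolution (ΔY = 0 kills every mixed term; CPRV's ρ = 2, CampostriniEtAl1998 §2.1,
§4.2, in real-space dress), so along any
flow ∂G = G∗K∗G anisotropy ratios are diluted at rate ξ⁻²; on ℤ³ the flow is β ↦ G_β with the
GKS-positive increment kernel
∂_βG = Σ_b⟨ε_b;σ₀σ_x⟩ ≥ 0 (KellySherman1968), whose positivity caps harmonic amplification by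
Funk–Hecke (SteinWeiss1971 Ch. IV) and whose exact
current meaning is the excess current mass ∂_β log G = β⁻¹(E^{0x}−E^∅)|n| (card H3–H4). The crux AH
states the resulting contraction as an
inequality between β-increments of moment sums — thermodynamic, series-friendly quantities
(CampostriniEtAl1997 measure exactly these, ρ ≈ 2.0
for 3D Ising). What no prior route does: isotropy is attacked on the SUBCRITICAL side with Griffiths
positivity and transferred to β_c through a
ξ₂-window crux (CLW, in the language of DuminilcopinPanis2025's sharp length) by moment determinacy
— no reflection-positivity analyticity
(HyperoctahedralRP), no auxiliary lattice, no RG map, no limit object until the last step. Areas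
imported: harmonic polynomials / Fischer
decomposition and Funk–Hecke (classical harmonic analysis), Carleman moment determinacy (classical
analysis), Karamata regular variation (for the
transfer), ODE comparison; the negatives index (one SAW item) is not touched.

RANKED CRUXES. #2 AngularHierarchy (crux) — ANGULAR HIERARCHY (card (AH), all cubic harmonics,
inductive in the total degree q = n + 2m). For the subcritical n.n. Ising two-point function G_β =
twoPointFree 3 β on ℤ³, every harmonic homogeneous polynomial Y of degree n ≥ 1 (Σ_i ∂_i²Y = 0) and
radial order m: IF all anisotropy ratios a_(Y',m') = k_(Y',m')/M_(n'+2m') of lower total degree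
n'+2m' < q tend to 0 as β ↑ β_c, THEN the moment k_(Y,m)(β) = Σ_x Y(x)|x|^(2m)G_β(x) varies slower
than the isotropic moment M_q(β) = Σ_x|x|^q G_β(x) by a contraction factor: ∃θ<1 ∀ε>0 ∃β₀<β_c
∀β₀≤β₁<β₂<β_c, |k(β₂)−k(β₁)| ≤ (θ·sup_[β₁,β₂]|k/M_q| + ε)·(M_q(β₂)−M_q(β₁)). A THEOREM with θ =
transport/(transport + isotropic source) < 1 for every convolution hierarchy ∂G = G∗K∗G (lattice
GFF, killed SRW; card H1–H2 = CPRV's ρ = 2): harmonic moments are unsourced, isotropic ones are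
sourced by lower moments. On ℤ³ the increment kernel is D = Σ_b⟨ε_b;σ₀σ_x⟩ ≥ 0 and a = k/M relaxes
toward a_D = Δk/ΔM at the divergent rate ΔM/M, so AH says a_D ≤ θa + ε: positive kernels do not
amplify harmonics faster than the mean (Funk–Hecke, card H3) and the 3-point function carries no
independent ℓ-harmonic source at leading order (lattice shadow of 'the spin-4 cubic operator is
irrelevant', ρ = 2 + η − η₄ ≈ 2.02; under scaling θ = 1 − ρν/(γ+qν) ≈ 0.66 at q = 4). Trivially true
for Y without O_h-invariant part (k ≡ 0). [difficulty: XL] (why it might fail: ∂_βG=Σ_b⟨ε_b;σ₀σ_x⟩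
is infrared-dominated (|b|≲ξ), so the 3-point function's own ℓ=4 content is an independent source;
Lebowitz' pointwise bound destroys the sign cancellation a harmonic weight needs; θ→1 (ρ=0, marginal
cubic operator) breaks the contraction.) [CampostriniEtAl1998, CampostriniEtAl1997, Cardy1996,
SteinWeiss1971, KellySherman1968, Lebowitz1974, AizenmanCMP1982]
#3 CorrelationLengthWindow (crux) — ξ₂-WINDOW of the near-critical two-point function (card D5 made
precise; the transfer input). With χ(β) = Σ_x G_β(x), M₂(β) = Σ_x|x|²G_β(x) and ξ₂(β)² := M₂/χ
(second-moment correlation length up to a constant): (i) CRITICAL INSIDE ξ₂ — ∀ε>0 ∃s>0 ∃β₀<β_c such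
that G_β(x) ≥ (1−ε)·⟨σ₀σ_x⟩_(β_c) whenever |x|²·χ(β) ≤ s·M₂(β) and β₀ ≤ β < β_c (G_β ≤ G_(β_c) is
Griffiths); current reading via ∂_β log G_β(x) = β⁻¹(E^(0x)−E^∅)|n| =: m_β(x)/β: the excess current
mass accumulated across the critical window, ∫_β^(β_c) m_u(x)du, is small for a source pair well
inside ξ₂ (physically ≈ (|x|/ξ)^(1/ν)); (ii) ONE LENGTH — ∃c,C>0 ∃β₀ ∀β∈[β₀,β_c) ∀A≥1:
Σ_(|x|>A·ξ₂(β)) G_β(x) ≤ C·e^(−cA)·χ(β), i.e. relative exponential tails at scale ξ₂ (sharp length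
L(β) ≲ ξ₂(β); Simon–Lieb iteration gives the tails at scale L(β)). DuminilcopinPanis2025 Def. 1.1
and eq. after it ('the distance below which the model recovers critical features'; G_β ≤
C(|x|∧L)^(2−d)e^(−c|x|/L)), Thm 1.6 (d ≥ 4: L = ξ^(1+o(1))). [difficulty: L] (why it might fail:
Hyperscaling-type consistency, open in d=3: (i) needs (β_c−β)·m_β(x)→0 for |x|≪ξ₂, i.e. the thermal
perturbation's growth |x|^{3−Δ_ε} matched to ν; (ii) needs L(β)≍ξ₂(β); the η-gap c|x|⁻²≤G≤C|x|⁻¹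
blocks both (DC–Panis get L=ξ^{1+o(1)} only for d≥4).) [DuminilcopinPanis2025,
DuminilCopinTassionCMP2016, AizenmanDuminilCopinAnnals2021, Simon1980, CampostriniEtAl1998,
FriedliVelenik2017]
#4 RotationUpgrade (crux) — n-POINT ROTATION UPGRADE. If the critical two-point function on ℤ³ is
asymptotically rotation invariant in the vague sense (the formula of TwoPointAsymptoticIsotropy: for
every continuous compactly supported test function φ ≥ 0, φ ≢ 0, on ℝ³ and every R ∈ O(3), Σ_x
φ(Rx/L)⟨σ₀σ_x⟩_(β_c) / Σ_x φ(x/L)⟨σ₀σ_x⟩_(β_c) → 1 as L → ∞), then every pointwise scaling limit S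
of criticalCorr 3 (ρ > 0 on (0,1]) that is normalised (S = 0 off NonCoincident, the typing fix of
Theorems/IsingEuclidUpgradeRefutations.lean), non-degenerate, translation invariant and scale
covariant with some Δ is IsRotationInvariant (all n, O(3) incl. reflections). n = 2 is glue (Riemann
sums of the rescaled correlator against φ, continuity of S₂ off 0 from Messager–Miracle-Solé +
homogeneity); n ≥ 3 is the crux: intended engines are the same harmonic-moment β-flow for ∂_β⟨σ_A⟩ =
Σ_b⟨ε_b;σ_A⟩ ≥ 0 in the joint-rotation harmonics of (x₂−x₁,…,x_n−x₁), or nine-direction OS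
continuation (route HyperoctahedralRP item (B)), or modular boosts (card
rotations-are-boosts-modular). Same hypotheses shape as HyperoctahedralRP.LimitRotationInvariant
with the lattice two-point isotropy in place of HRP2Rigidity. [difficulty: XL] (why it might fail:
Two-point isotropy does not force n-point isotropy for general scale-covariant families (round S₂
with only cubic-invariant S₄ is consistent); Σ_b⟨ε_b;σ_A⟩ has no convolution closure for |A|≥4, and
no multi-time OS continuation theorem on ℤ³ is in print.) [DuminilCopinICM2022, arXiv:2012.11672,
OsterwalderSchrader1973, GlimmJaffe1987, MessagerMiracleSoleJSP1977, ChelkakHonglerIzyurov2015]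
#5 ExistsScaleCovariantLimit (crux) — [shared with route HyperoctahedralRP, item
stmt-CriticalPhenomena-1981, identical Lean text] There are ρ > 0 on (0,1], Δ > 0 and S with
HasPointwiseScalingLimit (criticalCorr 3) ρ S, S = 0 off NonCoincident, IsNondegenerateTwoPoint S,
IsTranslationInvariant S, IsScaleCovariant Δ S — NO rotation clause (isotropy is OUTPUT of this
route). Used twice here: as the existence input of the assembly and as the radial-regularity input
of DilutionTransfer (a scale-covariant non-degenerate limit forces ρ(δ) regularly varying of index
−Δ and ⟨σ₀σ_x⟩_(β_c) ≍ |x|^(−2Δ)ℓ(|x|) uniformly in the direction, which is all the Karamata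
bookkeeping the transfer needs). [difficulty: open-problem] (why it might fail: Full δ→0⁺
convergence with ONE continuous Δ is open on ℤ³: only subsequential limits follow from the two-point
bounds, and RP/GKS two-point axiomatics admit log-periodic (discretely scale covariant) profiles.)
[DuminilCopinICM2022, DuminilcopinPanis2025, AizenmanDuminilCopinAnnals2021, arXiv:1912.07973]
#6 InversionUpgradeNormalised (crux) — [shared with route HyperoctahedralRP, item
stmt-CriticalPhenomena-1982, identical Lean text] Every pointwise scaling limit S of criticalCorr 3
(ρ > 0 on (0,1]) that is normalised (S = 0 off NonCoincident), non-degenerate, Euclidean invariant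
and scale covariant with Δ is IsInversionCovariant Δ (hence Möbius). Model-blind version false
(Literature.Barriers.CriticalPhenomena.ScaleCovarianceNotMoebius); any proof uses the Ising
hypothesis (RP + locality / no dimension-2 virial current). [difficulty: open-problem] (why it might
fail: Scale + RP + Euclid ⇏ Möbius in general (free Maxwell d=3; RP descendant witnesses); for Ising
it fails if the limit carries a virial current of dimension exactly 2 or lacks a local stress tensor
— excluded only by Monte-Carlo (Δ_V > 5).) [ElshowkNakayamaRychkov2011, Nakayama2015,
DelamotteTissierWschebor2016, PolandRychkovVichi2019, MenesesEtAl2019, DuminilCopinICM2022]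
#7 IsingEuclidUpgradeR4NonGaussian (crux) — [shared with routes IsingEuclidUpgrade / IsingCFTData /
HyperoctahedralRP, item stmt-CriticalPhenomena-0636, identical Lean text] Every non-degenerate
pointwise scaling limit S of the renormalised critical Ising correlators on ℤ³ has connected
four-point function U₄ ≢ 0 on non-coincident configurations (random-current intersection identity;
its negation refutes the conjunct itself). [difficulty: open-problem] (why it might fail: No proof
that U₄ ≢ 0 in d = 3: the double-current intersection probability at macroscopic separation must
stay > 0 as δ → 0; RP long-range models ON ℤ³ (α < 3/2) are Gaussian (LongRangeTrivialityOnZ3).)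
[AizenmanDuminilCopinAnnals2021, AizenmanCMP1982, DuminilCopinICM2022]
#9 HarmonicDilution (support) — [milestone; conclusion of HierarchyClosure, hypothesis of
DilutionTransfer] SUBCRITICAL HARMONIC DILUTION: for every harmonic homogeneous polynomial Y of
degree n ≥ 1 and every m ≥ 0, the anisotropy ratio a_(Y,m)(β) = Σ_x Y(x)|x|^(2m)G_β(x) / Σ_x
|x|^(n+2m)G_β(x) tends to 0 as β ↑ β_c(3). This is 'ρ_Y > 0 for every cubic harmonic' in its weakest
(no-rate) form; CPRV predict ρ = 2 + η − η₄ ≈ 2.02 for ℓ = 4 (CampostriniEtAl1998 eq. (2.28), §4.6;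
HT estimate CampostriniEtAl1997) and larger ρ for ℓ = 6, 8, …. Filed standalone so that other
isotropy routes can want it; false ⇒ clause (ii) of the conjunct fails at the two-point level near
criticality. [difficulty: open-problem] [CampostriniEtAl1998, CampostriniEtAl1997, Cardy1996]
#9 HierarchyClosure (support) — [glue, ODE comparison] AngularHierarchy → HarmonicDilution (formula
inlined). Proof: strong induction on q = n + 2m; at level q, AH supplies θ < 1; since M_q(β) ≥ χ(β)
− 1 → ∞ as β ↑ β_c (tendsto_susceptibility_nhdsLT_criticalBeta, proved) and |a| ≤ C(Y) (|Y(x)| ≤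
C|x|^n), the integrated inequality gives, for A := limsup|a|: |a(β₂)| ≤ |k(β₁)|/M_q(β₂) +
(θ(A+η)+ε)(1 − M_q(β₁)/M_q(β₂)), hence A ≤ θ(A+η) + ε for all η, A ≤ ε/(1−θ) for all ε, A = 0.
Inputs in tree: twoPoint_exponentialDecay_of_lt_criticalBeta_holds (summability of |x|^q G_β, β <
β_c), Griffiths monotonicity in β, lattice symmetries of twoPointFree (k ≡ 0 when Y has no
O_h-invariant part). Pure real analysis otherwise (no continuity in β needed). [difficulty:
provable-now] [FriedliVelenik2017, AizenmanBarskyFernandezJSP1987, DuminilCopinTassionCMP2016,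
CampostriniEtAl1998]
#9 TwoPointAsymptoticIsotropy (support) — [milestone; conclusion of DilutionTransfer, hypothesis of
RotationUpgrade] VAGUE ASYMPTOTIC ISOTROPY of the critical two-point function on ℤ³: for every
continuous compactly supported φ ≥ 0 on ℝ³ with φ ≢ 0 and every R ∈ O(3) (Matrix.orthogonalGroup),
Σ_x φ(R x/L)·⟨σ₀σ_x⟩_(β_c) / Σ_x φ(x/L)·⟨σ₀σ_x⟩_(β_c) → 1 as L → ∞. The lattice, test-function form
of the rotational half of item stmt-CriticalPhenomena-0634 (IsingEuclidUpgradeR2RotInvPowerLaw): no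
power law and no pointwise regularity presupposed; with a pointwise scaling limit it yields S₂(0,Rx)
= S₂(0,x) (Riemann sums + MMS continuity), the continuum milestone
HyperoctahedralRP.TwoPointLimitIsotropic. Open on ℤ³ (rotation invariance only postulated,
DuminilCopinICM2022 §8.1 p.25); planar analogue arXiv:2012.11672; d > 4 via lace expansion
(Sakai2007). [difficulty: open-problem] [DuminilCopinICM2022, arXiv:2012.11672, Sakai2007,
CampostriniEtAl1998, MessagerMiracleSoleJSP1977]
#9 DilutionTransfer (support) — [glue with teeth, Difficulty L] HarmonicDilution →
CorrelationLengthWindow → ExistsScaleCovariantLimit → TwoPointAsymptoticIsotropy (formulas inlined).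
Proof sketch: ν_β := χ(β)⁻¹ Σ_x G_β(x)·δ_(x/ξ₂(β)), probability measures on ℝ³; CLW(ii) ⇒ uniformly
bounded exponential moments ⇒ tight, subsequential weak limits ν with all moments, moments converge;
HarmonicDilution ⇒ ∫Y(y)|y|^(2m)dν = lim a_(Y,m)(β)·∫|y|^(n+2m)dν_β = 0 for every harmonic Y of
degree ≥ 1 and m ≥ 0, so by the Fischer decomposition P = Σ_j |y|^(2j)H_j every polynomial has the
same ν- and ν̄-integral (ν̄ = O(3)-average); Carleman (exponential moments) ⇒ ν = ν̄ is
O(3)-invariant. ExistsScaleCovariantLimit ⇒ ρ(δ) regularly varying of index −Δ ∈ [−1,−1/2] and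
⟨σ₀σ_x⟩_(β_c) ≍ |x|^(−2Δ)ℓ(|x|) uniformly in x̂ (locally uniform convergence on 1 ≤ |y| ≤ 2, S₂ > 0
continuous by MMS + homogeneity), so by Karamata every shell {r₁R < |x| ≤ r₂R} carries a fixed
fraction of the critical mass Σ_(|x|≤AR)⟨σ₀σ_x⟩_(β_c); with CLW(i) (G_β ≥ (1−ε)G_(β_c) inside √s ξ₂)
this makes ν charge every shell inside radius √s. Given φ, R and L → ∞ choose β(L) ↑ β_c with
ξ₂(β(L)) = L·r_φ/√s (ξ₂ continuous, → ∞): both sums in the ratio equal χ(β)∫φ_s∘(R or id)dν_β up to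
factors in [1, 1/(1−ε)], and ∫φ_s∘R dν = ∫φ_s dν > 0; hence limsup|ratio − 1| ≤ f(ε) → 0. Inputs:
messager_miracleSole_holds/_diag_holds, criticalTwoPoint_bounds_holds,
twoPointPlus_criticalBeta_eq_twoPointFree_holds, continuity of β ↦ G_β(x) below β_c; Mathlib lacks
regular variation and multivariate Carleman (to be proved in Theorems). [difficulty: L]
[DuminilcopinPanis2025, MessagerMiracleSoleJSP1977, Hegerfeldt1977, CampostriniEtAl1998,
SteinWeiss1971, AizenmanDuminilCopinAnnals2021]

TWO-LAYER PLAN. Foreseen glued splits (none filed now, k ≤ 3, depth 1): AngularHierarchy ⇐ AH4 (the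
decisive first instance: Y = K₄ = Σx_i⁴ − (3/5)|x|⁴, m = 0,
no induction hypothesis) → AHInduction (q > 4 given all lower ratios → 0) → AngularHierarchy; AH4 ⇐
NearFieldNonSourcing (bonds |b| ≤ |x|^{1−δ}
contribute ≤ inherited + lattice terms, via one-odd-operator universality ⟨σ₀ε_b;σ_x⟩ ≈ c_bG +
c′_bΔG and K₄[ΔG] = boundary; card D4) →
FarFieldHarmonicBound (|b| ≳ |x|: excess-mass isotropy) → AH4. CorrelationLengthWindow ⇐
InnerCriticality (i) → OneLength (ii) → CLW (a plain
conjunction). RotationUpgrade ⇐ LatticeToLimitIsotropy (TwoPointAsymptoticIsotropy →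
HyperoctahedralRP.TwoPointLimitIsotropic, item 1984, glue)
→ NPointHarmonicFlow (n ≥ 3) → RotationUpgrade. A pointwise dividend TwoPointAsymptoticIsotropy ∧
axis power law → item 0634 is glue once local
regularity of ⟨σ₀σ_x⟩_{β_c} (G(x′)/G(x) → 1 for |x′−x| = o(|x|)) is available.

KILL CRITERIA. HarmonicDilution refuted (some cubic-harmonic ratio a_{Y,m}(β) ↛ 0 as β ↑ β_c, e.g.
from certified HT-series/Monte-Carlo bounds) kills the route
outright (close refuted:AngularHierarchy via HierarchyClosure) AND refutes rotation invariance of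
any near-critical scaling limit — a result in
itself. AngularHierarchy refuted with HarmonicDilution standing (θ → 1: marginal restoration, ρ = 0
with logarithms) ⇒ pivot AH to a logarithmic
contraction (restate, same decl). CorrelationLengthWindow(ii) refuted (two parametrically different
lengths L ≫ ξ₂) ⇒ restate the window in
sharp-length units; (i) refuted ⇒ the subcritical-to-critical transfer is dead and the route closes
refuted:CorrelationLengthWindow unless AH can
be run on sharp-length-truncated moments. RotationUpgrade cannot be refuted model-blindly (it
quantifies over Ising limits); a cubic-but-not-O(3)
four-point structure found numerically would pivot the n-point step to the nine-mirror OS engine.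
EX/INV/U4 are shared: their refutation kills the
conjunct or all routes alike. TwoPointLimitIsotropic (HRP item 1984) or item 0634 proved elsewhere
moots AH/CLW/DilutionTransfer but not RU.

NOT DECOMPOSED YET. The first instance AH4 and the near- /far-field split of the bond sum (layer-2
children of AH, above); the excess-current-mass formulation
m_β(x) = E^{0x}|n| − E^∅|n| as a Lean object (needs infinite-volume sourced currents; Literature
RandomCurrents is finite-graph); continuity and
differentiability of β ↦ ⟨σ₀σ_x⟩_β below β_c (AH is stated in integrated form precisely to avoid
them); the Karamata/regular-variation and
multivariate-Carleman lemmas inside DilutionTransfer (Mathlib has neither; provers attach them with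
--supports DilutionTransfer); the n ≥ 3
harmonic flow behind RU; constants θ, s, c, C.

CHEAPEST FALSIFIER. (1) Series check of HarmonicDilution/AH at (K₄, m = 0): from the existing
25th-order sc-lattice HT series of q_{4,0}(β) = Σ K₄(x)G_β(x) and
m₄(β) (Butera–Comi / CPRV tables) estimate ρ in a₄ ~ ξ^{−ρ} and θ_eff = lim Δk/(a·ΔM) = 1 −
ρν/(γ+4ν): the line dies if ρ ≤ 0 (θ_eff ≥ 1);
CPRV's own analysis gives ρ = 2 + σ, σ ≈ 0.01–0.02 > −2 (CampostriniEtAl1998 §4.6, Table 'sigma'),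
i.e. θ_eff ≈ 0.66 — consistent, not run by me
(kit job for a refuter: Padé/DLog of q_{4,0}/m₄). (2) Worm-algorithm measurement of the excess
current mass m(x) = E^{0x}|n| − E^∅|n| on axis /
face diagonal / body diagonal at |x| = 16…64, β = β_c: a persistent ℓ = 4 component of relative size
≫ |x|^{−2} refutes the sharp form of AH.
(3) CLW(ii): the universal ratio ξ_{2nd}/ξ_{gap} for 3D Ising is ≈ 1.000(2) in the HT phase
(Campostrini–Pelissetto–Rossi–Vicari), consistent
with one length. (4) Lookup done: no rigorous isotropy statement for ℤ³, d = 3, exists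
(DuminilCopinICM2022 §8.1; crossref/galaxy searches in
§ Novelty).

NUMBERS. ρ = 2 + η − η₄ (CampostriniEtAl1998 eq. (2.28)); σ = η − η₄ = (7/20)(N+2)/(N+8)² ε² + O(ε³)
≈ 0.013 at N = 1 (ibid. §4.4); HT/strong-coupling:
ρ ≈ 2.0 for all N (ibid. abstract, §4.6; CampostriniEtAl1997). 3D Ising: ν ≈ 0.630, γ ≈ 1.237, η ≈
0.036, Δ_ε ≈ 1.41, leading ℓ = 4 operator
Δ ≈ 5.02 (PolandRychkovVichi2019) ⇒ expected contraction θ = 1 − ρν/(γ+4ν) ≈ 0.66 at q = 4. Rigorous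
window: c|x|⁻² ≤ ⟨σ₀σ_x⟩_{β_c} ≤ C|x|⁻¹
(criticalTwoPoint_bounds_holds), Δ ∈ [1/2, 1] (scalingDimension_mem_Icc_holds), η ≤ 1/2 if it exists
(DuminilcopinPanis2025 Thm 1.5), sharp-length
bound G_β ≤ C(|x| ∧ L(β))^{−1} e^{−c|x|/L(β)} (ibid. §1.1). Items at open: 11 (6 cruxes, 4 supports,
1 assembly).

DEFINITION REQUESTS. None needed to state the items (twoPointFree, criticalTwoPoint, criticalBeta,
MvPolynomial.pderiv/IsHomogeneous, Matrix.orthogonalGroup, CorrFamily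
predicates all exist; every constant `lean search --decl`-verified and the whole file elaborated, rc
0). Wanted later (not filed now): the sharp
length L(β) of DuminilcopinPanis2025 Def. 1.1 as `Literature.Probability.LatticeModels.sharpLength`,
and its near-critical upper bound as a cite
fact; infinite-volume sourced random currents for the excess-mass reading of AH.

Novelty: Searches (2026-08-15): `lit search --source crossref "rotational invariance restoration anisotropy
two-point function lattice critical exponent"`
(12 rows: CampostriniEtAl1997 = doi:10.1209/epl/i1997-00286-8, Fujimoto 1994
doi:10.1088/0305-4470/27/15/011 hard squares, Paul–Stanley 1971,
lattice-QCD 'restoring rotational invariance' doi:10.1007/jhep10(2022)069 — all numerics/physics);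
`lit search --hybrid "harmonic polynomial
moments of the two-point function anisotropy irrelevant operator rotational invariance restoration"`
(10 docs: Cardy1996 pp.53,181; image-moment
invariants (Flusser 2016); lattice-Boltzmann 4th-order isotropy conditions (Krüger 2017 p.429) — the
nearest KNOWN cousin of 'harmonic moments of
cubic stencils'); `lit galaxy search "restoration of rotational invariance" --star all` (7 rows,
lattice QCD monographs only); `lit galaxy search
"anisotropy of the two-point function" --star all` and two more galaxy queries: queue saturated (>90
s), logged; `lit frontier CriticalPhenomena
--since 2021` (30 rows, none on ℤ³ isotropy; arXiv:2604.05772 'Percolation in the 3D Ising model'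
noted); `lit bridges CriticalPhenomena --cross
any` (30 rows, nothing relevant); `lit read arXiv:cond-mat/9705086` pp.7,16,19–21 and `lit read
arXiv:2404.05700` pp.4–6 (quoted above);
openalex/s2/arxiv backends HTTP 429 this session (recorded in NOTES.md). In-tree: the five Theses of
the sub (isotropy only via nine-mirror RP),
items 0634/1984, negatives index (1 SAW item).
Nearest prior a  [refs: 10.1209/epl/i1997-00286-8, 10.1088/0305-4470/27/15/011, 10.1007/jhep10(2022, 10.1103/physreve.57.184, 2604.05772, cond-mat/9705086, 2404.05700, 2012.11672, doi:10.1209/epl/i1997-00286-8, doi:10.1088/0305-4470/27/15/011, doi:10.1007/jhep10, doi:10.1103/physreve.57.184, CampostriniEtAl1997, Cardy1996, CampostriniEtAl1998, Sakai2007, Hara2008, DuminilcopinPanis2025]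

Barriers (technique_class: harmonic-moment-hierarchy, beta-flow-inequalities): - technique_class: harmonic-moment-hierarchy, beta-flow-inequalities
- Literature.Barriers.CriticalPhenomena.LiouvilleRigidity: respected and not engaged — no conformal
maps, discrete holomorphicity or SLE; only O(3) ⊂ Möbius is targeted, by moment sums on the lattice;
the inversion is imported (InversionUpgradeNormalised).
- Literature.Barriers.CriticalPhenomena.ScaleCovarianceNotMoebius: applies only to the imported crux
InversionUpgradeNormalised, which keeps HasPointwiseScalingLimit (criticalCorr 3) and the
NonCoincident normalisation the barrier and Theorems/IsingEuclidUpgradeRefutations.lean leave open;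
the route's own cruxes concern rotations, outside the class EuclideanScaleUpgrade.
- Literature.Barriers.CriticalPhenomena.LaceExpansionIsingAboveFour: not met — no expansion is
summed and no small parameter is used; the convolution class (GFF/SRW, d > 4 Ising) is only the
solvable rung where AH is a theorem, and the card states why d = 3 is outside it (unsaturated
Lebowitz bound, Δ_ε > 2Δ_σ).
- Literature.Barriers.CriticalPhenomena.RigorousRGSmallParameter: not met — the 'flow' is β ↦
⟨σ₀σ_x⟩_β of the fixed n.n. model (Griffiths-monotone, analytic below β_c), not an RG map; no fixed
point is constructed.
- Literature.Barriers.CriticalPhenomena.PositionSpaceRGNonGibbsian: not met for the same reason (no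
block-spin / decimated measure appears).
- Literature.Barriers.CriticalPhenomena.BootstrapLatticeBlindness: evaded — every crux is a lattice
statement about ⟨σ₀σ_x⟩_β on

History (route lifecycle, newest last):
- 2026-08-25T15:58:01Z · DORMANT — reconciler: no traction for 7.8 d (last activity item-evidence-added at 2026-08-17T19:18:53Z); parked, not closed — `ledger route dormant route-CriticalPhenomen (operator:999:2139141)
- 2026-08-27T13:17:27Z · REACTIVATED — reconciler: reactivated — activity statement-claimed at 2026-08-27T11:07:20Z after parking at 2026-08-25T15:58:01Z (operator:999:941147)
- 2026-08-29T19:30:12Z · DORMANT — census g0: costume|duplicate of route-CriticalPhenomena-HyperoctahedralRP; reader census-reader-35-g0 (operator:999:1076470)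

sub-problem: Ising3DConformalLimit · status: dormant · opened planner-plancard-CriticalPhenomena-Ising3DCon-313ff339-0 2026-08-15T11:44:05Z · rev 3 · ledger route-CriticalPhenomena-HarmonicMomentsIsotropy
GENERATED by the gate from the ledger (D-0016/17). Provers cite these decls: `theorem foo : Summit.CriticalPhenomena.Ising3DConformalLimit.Theses.HarmonicMomentsIsotropy.<Decl> := …` in Summits/CriticalPhenomena/Ising3DConformalLimit/Theorems/<Name>.lean.
-/

namespace Summit.CriticalPhenomena.Ising3DConformalLimit.Theses.HarmonicMomentsIsotropy

open scoped BigOperators Topology Manifold Classical MeasureTheory ProbabilityTheory Matrix InnerProductSpace ComplexConjugate ContinuousMap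
open Filter Set Function TopologicalSpace MeasureTheory

attribute [summit_statement] _root_.Ising3DConformalLimit

/-- item stmt-CriticalPhenomena-6031 · crux · rank 2 · open · by planner
why it might fail: As β↦G_β is C¹ below β_c, AH ⇔ eventually |k′| ≤ (θ|a|+ε)M′: false if the ℓ=4 cubic operator is marginal/relevant on ℤ³ (ρ=2+η−η₄ ≤ 0 ⇒ θ→1; only HT/1/N/ε-expansion evidence ρ≈2.02, CPRV p.7); ∂_βG=Σ_b⟨ε_b;σ₀σ_x⟩ is infrared-dominated, an independent ℓ=4 source Lebowitz/GHS bounds cannot sign.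
sources: CampostriniEtAl1998, CampostriniEtAl1997, Cardy1996, SteinWeiss1971, KellySherman1968, Lebowitz1974
[crux] ANGULAR HIERARCHY (card (AH), all cubic harmonics, inductive in the total degree q = n + 2m).
For the subcritical n.n. Ising two-point function G_β = twoPointFree 3 β on ℤ³, every harmonic
homogeneous polynomial Y of degree n ≥ 1 (Σ_i ∂_i²Y = 0) and radial order m: IF all anisotropy
ratios a_(Y',m') = k_(Y',m')/M_(n'+2m') of lower total degree n'+2m' < q tend to 0 as β ↑ β_c, THEN
the moment k_(Y,m)(β) = Σ_x Y(x)|x|^(2m)G_β(x) varies slower than the isotropic moment M_q(β) =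
Σ_x|x|^q G_β(x) by a contraction factor: ∃θ<1 ∀ε>0 ∃β₀<β_c ∀β₀≤β₁<β₂<β_c, |k(β₂)−k(β₁)| ≤
(θ·sup_[β₁,β₂]|k/M_q| + ε)·(M_q(β₂)−M_q(β₁)). A THEOREM with θ = transport/(transport + isotropic
source) < 1 for every convolution hierarchy ∂G = G∗K∗G (lattice GFF, killed SRW; card H1–H2 = CPRV's
ρ = 2): harmonic moments are unsourced, isotropic ones are sourced by lower moments. On ℤ³ the
increment kernel is D = Σ_b⟨ε_b;σ₀σ_x⟩ ≥ 0 and a = k/M relaxes toward a_D = Δk/ΔM at the divergent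
rate ΔM/M, so AH says a_D ≤ θa + ε: positive kernels do not amplify harmonics faster than the mean
(Funk–Hecke, card H3) and the 3-point function carries no independent ℓ-harmonic source at leading
order (lattice shadow of 'the sp -/
@[route_item "route-CriticalPhenomena-HarmonicMomentsIsotropy", crux]
def AngularHierarchy : Prop :=
  let G : ℝ → Literature.Probability.LatticeModels.Site 3 → ℝ := Literature.Probability.LatticeModels.twoPointFree 3; let nE : Literature.Probability.LatticeModels.Site 3 → ℝ := (fun x : Literature.Probability.LatticeModels.Site 3 => Real.sqrt (∑ i, ((x i : ℝ)) ^ 2)); let k : MvPolynomial (Fin 3) ℝ → ℕ → ℝ → ℝ := fun Y m β => ∑' x : Literature.Probability.LatticeModels.Site 3, MvPolynomial.eval (fun i => (x i : ℝ)) Y * nE x ^ (2 * m) * G β x; let M : ℕ → ℝ → ℝ := fun q β => ∑' x : Literature.Probability.LatticeModels.Site 3, nE x ^ q * G β x; let a : MvPolynomial (Fin 3) ℝ → ℕ → ℕ → ℝ → ℝ := fun Y n m β => k Y m β / M (n + 2 * m) β; ∀ q : ℕ, (∀ (n m : ℕ) (Y : MvPolynomial (Fin 3) ℝ), 1 ≤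 n → n + 2 * m < q → Y.IsHomogeneous n → (∑ i : Fin 3, MvPolynomial.pderiv i (MvPolynomial.pderiv i Y)) = 0 → Filter.Tendsto (fun β => a Y n m β) (nhdsWithin (Literature.Probability.LatticeModels.criticalBeta 3) (Set.Iio (Literature.Probability.LatticeModels.criticalBeta 3))) (nhds 0)) → ∀ (n m : ℕ) (Y : MvPolynomial (Fin 3) ℝ), 1 ≤ n → n + 2 * m = q → Y.IsHomogeneous n → (∑ i : Fin 3, MvPolynomial.pderiv i (MvPolynomial.pderiv i Y)) = 0 → ∃ θ : ℝ, θ < 1 ∧ ∀ ε : ℝ, 0 < ε → ∃ β₀ : ℝ, β₀ < Literature.Probability.LatticeModels.criticalBeta 3 ∧ ∀ β₁ β₂ : ℝ, β₀ ≤ β₁ → β₁ < β₂ → β₂ < Literature.Probability.LatticeModels.criticalBeta 3 → |k Y m β₂ - k Y m β₁| ≤ (θ * sSup ((fun β => |a Y n m β|) '' Set.Icc β₁ β₂) + ε) * (M (n + 2 * m) β₂ - M (n + 2 * m) β₁)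

/-- item stmt-CriticalPhenomena-6032 · crux · rank 3 · open · by planner
why it might fail: ONE near-critical length ≍ ξ₂ on ℤ³ is unproved in d=3: DC–Panis (arXiv:2404.05700) get L(β)=ξ^{1+o(1)}=ξ_p^{1+o(1)} only for d≥4 (Thm 1.6; p.6 'the relation between these quantities is not clear a priori'); (i) needs uniform recovery G_β≥(1−ε)G_{β_c} up to √s·ξ₂ across the η-gap c|x|⁻²≤G≤C|x|⁻¹.
sources: DuminilcopinPanis2025, DuminilCopinTassionCMP2016, AizenmanDuminilCopinAnnals2021, Simon1980, CampostriniEtAl1998, FriedliVelenik2017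
[crux] ξ₂-WINDOW of the near-critical two-point function (card D5 made precise; the transfer input).
With χ(β) = Σ_x G_β(x), M₂(β) = Σ_x|x|²G_β(x) and ξ₂(β)² := M₂/χ (second-moment correlation length
up to a constant): (i) CRITICAL INSIDE ξ₂ — ∀ε>0 ∃s>0 ∃β₀<β_c such that G_β(x) ≥ (1−ε)·⟨σ₀σ_x⟩_(β_c)
whenever |x|²·χ(β) ≤ s·M₂(β) and β₀ ≤ β < β_c (G_β ≤ G_(β_c) is Griffiths); current reading via ∂_β
log G_β(x) = β⁻¹(E^(0x)−E^∅)|n| =: m_β(x)/β: the excess current mass accumulated across the critical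
window, ∫_β^(β_c) m_u(x)du, is small for a source pair well inside ξ₂ (physically ≈ (|x|/ξ)^(1/ν));
(ii) ONE LENGTH — ∃c,C>0 ∃β₀ ∀β∈[β₀,β_c) ∀A≥1: Σ_(|x|>A·ξ₂(β)) G_β(x) ≤ C·e^(−cA)·χ(β), i.e.
relative exponential tails at scale ξ₂ (sharp length L(β) ≲ ξ₂(β); Simon–Lieb iteration gives the
tails at scale L(β)). DuminilcopinPanis2025 Def. 1.1 and eq. after it ('the distance below which the
model recovers critical features'; G_β ≤ C(|x|∧L)^(2−d)e^(−c|x|/L)), Thm 1.6 (d ≥ 4: L =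
ξ^(1+o(1))). [difficulty: L] -/
@[route_item "route-CriticalPhenomena-HarmonicMomentsIsotropy", crux]
def CorrelationLengthWindow : Prop :=
  let G : ℝ → Literature.Probability.LatticeModels.Site 3 → ℝ := Literature.Probability.LatticeModels.twoPointFree 3; let r2 : Literature.Probability.LatticeModels.Site 3 → ℝ := (fun x : Literature.Probability.LatticeModels.Site 3 => ∑ i, ((x i : ℝ)) ^ 2); let χ : ℝ → ℝ := fun β => ∑' x : Literature.Probability.LatticeModels.Site 3, G β x; let M₂ : ℝ → ℝ := fun β => ∑' x : Literature.Probability.LatticeModels.Site 3, r2 x * G β x; (∀ ε : ℝ, 0 < ε → ∃ s : ℝ, 0 < s ∧ ∃ β₀ : ℝ, β₀ < Literature.Probability.LatticeModels.criticalBeta 3 ∧ ∀ β : ℝ, β₀ ≤ β → β < Literature.Probability.LatticeModels.criticalBeta 3 → ∀ x : Literature.Probability.LatticeModels.Site 3, r2 x * χ β ≤ s * M₂ β → (1 - ε) * Literature.Probability.LatticeModels.criticalTwoPoint 3 x ≤ G β x) ∧ (∃ c C : ℝ, 0 < c ∧ ∃ β₀ : ℝ, β₀ < Literature.Probability.LatticeModels.criticalBeta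 3 ∧ ∀ β : ℝ, β₀ ≤ β → β < Literature.Probability.LatticeModels.criticalBeta 3 → ∀ A : ℝ, 1 ≤ A → (∑' x : Literature.Probability.LatticeModels.Site 3, (if A ^ 2 * M₂ β < r2 x * χ β then G β x else 0)) ≤ C * Real.exp (-(c * A)) * χ β)

/-- item stmt-CriticalPhenomena-6033 · crux · rank 4 · open · by planner
why it might fail: Two-point isotropy does not force n-point isotropy for general scale-covariant families (round S₂ with only cubic-invariant S₄ is consistent); Σ_b⟨ε_b;σ_A⟩ has no convolution closure for |A|≥4, and no multi-time OS continuation theorem on ℤ³ is in print.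
sources: DuminilCopinICM2022, arXiv:2012.11672, OsterwalderSchrader1973, GlimmJaffe1987, MessagerMiracleSoleJSP1977, ChelkakHonglerIzyurov2015
[crux] n-POINT ROTATION UPGRADE. If the critical two-point function on ℤ³ is asymptotically rotation
invariant in the vague sense (the formula of TwoPointAsymptoticIsotropy: for every continuous
compactly supported test function φ ≥ 0, φ ≢ 0, on ℝ³ and every R ∈ O(3), Σ_x φ(Rx/L)⟨σ₀σ_x⟩_(β_c) /
Σ_x φ(x/L)⟨σ₀σ_x⟩_(β_c) → 1 as L → ∞), then every pointwise scaling limit S of criticalCorr 3 (ρ > 0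
on (0,1]) that is normalised (S = 0 off NonCoincident, the typing fix of
Theorems/IsingEuclidUpgradeRefutations.lean), non-degenerate, translation invariant and scale
covariant with some Δ is IsRotationInvariant (all n, O(3) incl. reflections). n = 2 is glue (Riemann
sums of the rescaled correlator against φ, continuity of S₂ off 0 from Messager–Miracle-Solé +
homogeneity); n ≥ 3 is the crux: intended engines are the same harmonic-moment β-flow for ∂_β⟨σ_A⟩ =
Σ_b⟨ε_b;σ_A⟩ ≥ 0 in the joint-rotation harmonics of (x₂−x₁,…,x_n−x₁), or nine-direction OS
continuation (route HyperoctahedralRP item (B)), or modular boosts (card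
rotations-are-boosts-modular). Same hypotheses shape as HyperoctahedralRP.LimitRotationInvariant
with the lattice two-point isotropy in place of HRP2Rigidity. [difficulty: XL] -/
@[route_item "route-CriticalPhenomena-HarmonicMomentsIsotropy", crux]
def RotationUpgrade : Prop :=
  (∀ (φ : (Fin 3 → ℝ) → ℝ), Continuous φ → HasCompactSupport φ → (∀ v, 0 ≤ φ v) → (∃ v, 0 < φ v) → ∀ R : Matrix.orthogonalGroup (Fin 3) ℝ, Filter.Tendsto (fun L : ℝ => (∑' x : Literature.Probability.LatticeModels.Site 3, φ (L⁻¹ • (R.1.mulVec (fun i => (x i : ℝ)))) * Literature.Probability.LatticeModels.criticalTwoPoint 3 x) / (∑' x : Literature.Probability.LatticeModels.Site 3, φ (L⁻¹ • (fun i => (x i : ℝ))) * Literature.Probability.LatticeModels.criticalTwoPoint 3 x)) Filter.atTop (nhds 1)) → ∀ (ρ : ℝ → ℝ) (Δ : ℝ) (S : Literature.Probability.LatticeModels.CorrFamily 3), (∀ δ ∈ Set.Ioc (0:ℝ) 1, 0 < ρ δ) → Literature.Probability.LatticeModels.HasPointwiseScalingLimit (Literature.Probability.LatticeModels.criticalCorr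 3) ρ S → (∀ n z, z ∉ Literature.Probability.LatticeModels.NonCoincident 3 n → S n z = 0) → Literature.Probability.LatticeModels.IsNondegenerateTwoPoint S → Literature.Probability.LatticeModels.IsTranslationInvariant S → Literature.Probability.LatticeModels.IsScaleCovariant Δ S → Literature.Probability.LatticeModels.IsRotationInvariant S

/-- item stmt-CriticalPhenomena-1981 · crux · rank 5 · SPLIT (gen 2) into TwoPointDoubling, ClusterSetTotallyDisconnected + glue Summit.CriticalPhenomena.Ising3DConformalLimit.Cruxes.ExistsScaleCovariantLimit.SplitGlue.hrp_crux_of_doubling_of_totallyDisconnected · direct attempts still welcome (low priority) · by planner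
why it might fail: Full δ→0⁺ convergence with ONE continuous Δ is open on ℤ³: only subsequential limits follow from the two-point bounds, and RP/GKS two-point axiomatics admit log-periodic (discretely scale covariant) profiles.
sources: DuminilCopinICM2022, DuminilcopinPanis2025, AizenmanDuminilCopinAnnals2021, arXiv:1912.07973
earlier split gen 1: TwoPointDoubling, ClusterSetTotallyDisconnected — retired -
[crux r4, (C), existence WITHOUT rotations] There are ρ > 0 on (0,1], Δ > 0 and S with
HasPointwiseScalingLimit (criticalCorr 3) ρ S, S = 0 off NonCoincident, IsNondegenerateTwoPoint S,
IsTranslationInvariant S, IsScaleCovariant Δ S. Strictly weaker than CritIsing3DEuclideanLimit (item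
0638: rotations included) — on this route isotropy is OUTPUT. Inputs in tree:
criticalTwoPoint_bounds_holds (c|x|⁻² ≤ G ≤ C|x|⁻¹ ⇒ subsequential limits, Δ ∈ [1/2,1]); missing:
uniqueness/full-filter convergence and continuous scale covariance (DuminilCopinICM2022 §8.4 p.29:
'widely open'). -/
@[route_item "route-CriticalPhenomena-HarmonicMomentsIsotropy", crux]
def ExistsScaleCovariantLimit : Prop :=
  ∃ (ρ : ℝ → ℝ) (Δ : ℝ) (S : Literature.Probability.LatticeModels.CorrFamily 3), (∀ δ ∈ Set.Ioc (0:ℝ) 1, 0 < ρ δ) ∧ 0 < Δ ∧ Literature.Probability.LatticeModels.HasPointwiseScalingLimit (Literature.Probability.LatticeModels.criticalCorr 3) ρ S ∧ (∀ n z, z ∉ Literature.Probability.LatticeModels.NonCoincident 3 n → S n z = 0) ∧ Literature.Probability.LatticeModels.IsNondegenerateTwoPoint S ∧ Literature.Probability.LatticeModels.IsTranslationInvariant S ∧ Literature.Probability.LatticeModels.IsScaleCovariant Δ S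

-- parent: ExistsScaleCovariantLimit · child (gen 2)
/--     item stmt-CriticalPhenomena-6150 · crux · rank 501 · open
    parent: ExistsScaleCovariantLimit · by planner
    why it might fail: Open in print (ADC21 Rem 5.10; DCP24 Thm 1.5): every two-point axiomatic in tree (all-mirror RP, MMS, IR + sliding-scale IR, DCP24 1.2/1.3, log-gradient) is passed by completely monotone episodic profiles losing doubling by unbounded factors (Disproof §E) — needs an Ising-specific 2-scale bound.
    sources: AizenmanDuminilCopinAnnals2021, arXiv:1912.07973, DuminilcopinPanis2025, arXiv:2404.05700, DuminilCopinICM2022, arXiv:2509.02850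
[crux] (D) ALL-SCALE DOUBLING of the axial critical two-point function on ℤ³: there is κ > 0 with
g(2n) ≥ κ·g(n) for all n ≥ 1, g(n) := ⟨σ₀σ_{n e₁}⟩⁺_{β_c(3)} (card item M3; = D1 of card
every-scale-regular-multiplicative-fekete). With MMS it gives G(z′) ≍ G(z) for ‖z′‖ ≍ ‖z‖ in all
directions; it is the one open LATTICE input of the compactness half and is filed first (the import
cone of everything below is otherwise proved: criticalTwoPoint_bounds_holds,
messager_miracleSole_holds, RP lemmas). [difficulty: open-problem] -/
@[route_item "route-CriticalPhenomena-HarmonicMomentsIsotropy", crux]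
def TwoPointDoubling : Prop :=
  ∃ κ : ℝ, 0 < κ ∧ ∀ n : ℕ, 1 ≤ n → κ * Literature.Probability.LatticeModels.criticalTwoPoint 3 (Pi.single 0 (n : ℤ)) ≤ Literature.Probability.LatticeModels.criticalTwoPoint 3 (Pi.single 0 (2 * (n : ℤ)))

-- parent: ExistsScaleCovariantLimit · child (gen 2)
/--     item stmt-CriticalPhenomena-4659 · crux · rank 502 · open
    parent: ExistsScaleCovariantLimit · by planner
    why it might fail: Fails if Δ drifts along scales, if the zoom has a limit cycle (DSI witnesses W_ε pass all two-point axiomatics with two cluster points, Disproof §E), or if cluster points evade locality / Ising₃ lies on a conformal manifold; isolation of local 3D CFTs is expected, not proved (Rychkov 2020 p.8).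
    sources: Rychkov2020, arXiv:2007.14315, PolandRychkovVichi2019, arXiv:1805.04405, DuminilCopinICM2022, Literature.Probability.LatticeModels.PointwiseScalingLimitDiscreteScaleInvariance
[crux] the cluster set 𝒞 of the self-normalised family is totally disconnected in the pointwise
(product) topology of CorrFamily 3 (on 𝒞, compact under Reg, this coincides with the locally uniform
topology; pointwise is the stronger ask otherwise). INTENDED ENGINE (card items (2)–(4), the route's
point, layer 2): 𝒞 ⊆ 𝓘 := σ-correlator families of LOCAL unitary ℤ₂-symmetric 3D CFTs with exactly
one relevant odd and exactly one relevant non-identity even scalar and Δ_σ ≤ 1 (lattice side: OS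
positivity, clustering, covariance and spectrum of cluster points), and 𝓘 is totally disconnected
(CFT side, lattice-blind: 'It is expected that most local CFTs are isolated. One exception are CFTs
with exactly marginal fields of dimension Δ = d … A folk conjecture says that exactly marginal
fields in d ≥ 3 require supersymmetry' — Rychkov2020, arXiv:2007.14315 p.8, read this session; LOCAL
= 'critical points of lattice models with finite-range interactions', ibid., which is what excludes
the non-local long-range arc; an ANALYTIC isolation theorem for exact solutions of crossing — NOT a
finite-Λ positivity certificate, which only gives diam ≤ ε(Λ): refuter flag on the card, accepted).
Both halves -/
@[route_item "route-CriticalPhenomena-HarmonicMomentsIsotropy", crux]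
def ClusterSetTotallyDisconnected : Prop :=
  IsTotallyDisconnected {S : Literature.Probability.LatticeModels.CorrFamily 3 | (∀ n x, x ∉ Literature.Probability.LatticeModels.NonCoincident 3 n → S n x = 0) ∧ ∃ u : ℕ → ℝ, (∀ k, u k ∈ Set.Ioc (0:ℝ) 1) ∧ Filter.Tendsto u Filter.atTop (nhds 0) ∧ ∀ n, TendstoLocallyUniformlyOn (fun k => Literature.Probability.LatticeModels.rescaledCorrelator (Literature.Probability.LatticeModels.criticalCorr 3) (fun δ : ℝ => (Literature.Probability.LatticeModels.criticalTwoPoint 3 (Pi.single 0 ⌊δ⁻¹⌋)) ^ (-(1/2:ℝ))) n (u k)) (S n) Filter.atTop (Literature.Probability.LatticeModels.NonCoincident 3 n)}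

/-- glue for the split of `ExistsScaleCovariantLimit`: landed theorem `Summit.CriticalPhenomena.Ising3DConformalLimit.Cruxes.ExistsScaleCovariantLimit.SplitGlue.hrp_crux_of_doubling_of_totallyDisconnected`. -/
theorem ExistsScaleCovariantLimitGlueBy_holds : TwoPointDoubling → ClusterSetTotallyDisconnected → ExistsScaleCovariantLimit := _root_.Summit.CriticalPhenomena.Ising3DConformalLimit.Cruxes.ExistsScaleCovariantLimit.SplitGlue.hrp_crux_of_doubling_of_totallyDisconnected

/-- item stmt-CriticalPhenomena-1982 · crux · rank 6 · open · by planner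
why it might fail: Scale + RP + Euclid ⇏ Möbius in general (free Maxwell d=3; RP descendant witnesses); for Ising it fails if the limit carries a virial current of dimension exactly 2 or lacks a local stress tensor — excluded only by Monte-Carlo (Δ_V > 5).
sources: ElshowkNakayamaRychkov2011, Nakayama2015, DelamotteTissierWschebor2016, PolandRychkovVichi2019, MenesesEtAl2019, DuminilCopinICM2022
[crux r5, (D), inversion upgrade re-typed] Every pointwise scaling limit S of criticalCorr 3 (ρ > 0
on (0,1]) that is normalised (S = 0 off NonCoincident), non-degenerate, Euclidean invariant and
scale covariant with Δ is IsInversionCovariant Δ (hence Möbius). This is (U) of route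
IsingEuclidUpgrade (item 0637, refuted AS TYPED by not_inversionUpgrade_of_euclideanLimit through
values on the coincident locus) with the normalisation hypothesis the refutation file prescribes;
the model-blind version is false (Literature.Barriers.CriticalPhenomena.ScaleCovarianceNotMoebius;
free Maxwell d=3, ElshowkNakayamaRychkov2011), so any proof must use the Ising hypothesis (RP +
locality / absence of a dimension-2 virial current: DelamotteTissierWschebor2016 §5–6,
Nakayama2015). -/
@[route_item "route-CriticalPhenomena-HarmonicMomentsIsotropy", crux]
def InversionUpgradeNormalised : Prop :=
  ∀ (ρ : ℝ → ℝ) (Δ : ℝ) (S : Literature.Probability.LatticeModels.CorrFamily 3), (∀ δ ∈ Set.Ioc (0:ℝ) 1, 0 < ρ δ) → Literature.Probability.LatticeModels.HasPointwiseScalingLimit (Literature.Probability.LatticeModels.criticalCorr 3) ρ S → (∀ n z, z ∉ Literature.Probability.LatticeModels.NonCoincident 3 n → S n z = 0) → Literature.Probability.LatticeModels.IsNondegenerateTwoPoint S → Literature.Probability.LatticeModels.IsEuclideanInvariant S → Literature.Probability.LatticeModels.IsScaleCovariant Δ S → Literature.Probability.LatticeModels.IsInversionCovariant Δ S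

/-- item stmt-CriticalPhenomena-0636 · crux · rank 7 · open · by planner
why it might fail: No proof that U₄ ≢ 0 in d = 3: the double-current intersection probability at macroscopic separation must stay > 0 as δ → 0; RP long-range models ON ℤ³ (α < 3/2) are Gaussian (LongRangeTrivialityOnZ3).
sources: AizenmanDuminilCopinAnnals2021, AizenmanCMP1982, DuminilCopinICM2022
Crux r4 (non-triviality in d=3): every non-degenerate pointwise scaling limit S of the renormalised
critical Ising correlators on Z^3 has connected four-point function U4 ≢ 0 on non-coincident
configurations. Intended tool: the random-current identity U4(x,y,z,t) =
−2⟨σxσy⟩⟨σzσt⟩·P^{xy,zt}[C_{n1+n2}(x) ∩ C_{n1+n2}(z) ≠ ∅] (Aizenman 1982; ADC2021 arXiv:1912.07973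
eq. (3.11)): non-Gaussianity ⇔ the intersection probability of the two double-current clusters at
macroscopic separation does not vanish as δ → 0. Contrast: for d ≥ 4 every such limit IS Gaussian
(Literature.Probability.LatticeModels.highDim_triviality). Its negation refutes the conjunct
Ising3DConformalLimit itself. -/
@[route_item "route-CriticalPhenomena-HarmonicMomentsIsotropy", crux]
def IsingEuclidUpgradeR4NonGaussian : Prop :=
  ∀ (ρ : ℝ → ℝ) (S : Literature.Probability.LatticeModels.CorrFamily 3), (∀ δ ∈ Set.Ioc (0:ℝ) 1, 0 < ρ δ) → Literature.Probability.LatticeModels.HasPointwiseScalingLimit (Literature.Probability.LatticeModels.criticalCorr 3) ρ S → Literature.Probability.LatticeModels.IsNondegenerateTwoPoint S → Literature.Probability.LatticeModels.HasNontrivialU4 S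

/-- item stmt-CriticalPhenomena-6034 · support · rank 9 · open · by planner
sources: CampostriniEtAl1998, CampostriniEtAl1997, Cardy1996
[support] [milestone; conclusion of HierarchyClosure, hypothesis of DilutionTransfer] SUBCRITICAL
HARMONIC DILUTION: for every harmonic homogeneous polynomial Y of degree n ≥ 1 and every m ≥ 0, the
anisotropy ratio a_(Y,m)(β) = Σ_x Y(x)|x|^(2m)G_β(x) / Σ_x |x|^(n+2m)G_β(x) tends to 0 as β ↑
β_c(3). This is 'ρ_Y > 0 for every cubic harmonic' in its weakest (no-rate) form; CPRV predict ρ = 2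
+ η − η₄ ≈ 2.02 for ℓ = 4 (CampostriniEtAl1998 eq. (2.28), §4.6; HT estimate CampostriniEtAl1997)
and larger ρ for ℓ = 6, 8, …. Filed standalone so that other isotropy routes can want it; false ⇒
clause (ii) of the conjunct fails at the two-point level near criticality. [difficulty:
open-problem] -/
@[route_item "route-CriticalPhenomena-HarmonicMomentsIsotropy", crux]
def HarmonicDilution : Prop :=
  let G : ℝ → Literature.Probability.LatticeModels.Site 3 → ℝ := Literature.Probability.LatticeModels.twoPointFree 3; let nE : Literature.Probability.LatticeModels.Site 3 → ℝ := (fun x : Literature.Probability.LatticeModels.Site 3 => Real.sqrt (∑ i, ((x i : ℝ)) ^ 2)); let k : MvPolynomial (Fin 3) ℝ → ℕ → ℝ → ℝ := fun Y m β => ∑' x : Literature.Probability.LatticeModels.Site 3, MvPolynomial.eval (fun i => (x i : ℝ)) Y * nE x ^ (2 * m) * G β x; let M : ℕ → ℝ → ℝ := fun q β => ∑' x : Literature.Probability.LatticeModels.Site 3, nE x ^ q * G β x; let a : MvPolynomial (Fin 3) ℝ → ℕ → ℕ → ℝ → ℝ := fun Y n m β => k Y m β / M (n + 2 * m) β; ∀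 (n m : ℕ) (Y : MvPolynomial (Fin 3) ℝ), 1 ≤ n → Y.IsHomogeneous n → (∑ i : Fin 3, MvPolynomial.pderiv i (MvPolynomial.pderiv i Y)) = 0 → Filter.Tendsto (fun β => a Y n m β) (nhdsWithin (Literature.Probability.LatticeModels.criticalBeta 3) (Set.Iio (Literature.Probability.LatticeModels.criticalBeta 3))) (nhds 0)

/-- item stmt-CriticalPhenomena-6035 · support · rank 9 · closed · proved by Summit.CriticalPhenomena.Ising3DConformalLimit.Theorems.hierarchyClosure_proof (prover) · by planner
sources: FriedliVelenik2017, AizenmanBarskyFernandezJSP1987, DuminilCopinTassionCMP2016, CampostriniEtAl1998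
[support] [glue, ODE comparison] AngularHierarchy → HarmonicDilution (formula inlined). Proof:
strong induction on q = n + 2m; at level q, AH supplies θ < 1; since M_q(β) ≥ χ(β) − 1 → ∞ as β ↑
β_c (tendsto_susceptibility_nhdsLT_criticalBeta, proved) and |a| ≤ C(Y) (|Y(x)| ≤ C|x|^n), the
integrated inequality gives, for A := limsup|a|: |a(β₂)| ≤ |k(β₁)|/M_q(β₂) + (θ(A+η)+ε)(1 −
M_q(β₁)/M_q(β₂)), hence A ≤ θ(A+η) + ε for all η, A ≤ ε/(1−θ) for all ε, A = 0. Inputs in tree: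
twoPoint_exponentialDecay_of_lt_criticalBeta_holds (summability of |x|^q G_β, β < β_c), Griffiths
monotonicity in β, lattice symmetries of twoPointFree (k ≡ 0 when Y has no O_h-invariant part). Pure
real analysis otherwise (no continuity in β needed). [difficulty: provable-now] -/
@[route_item "route-CriticalPhenomena-HarmonicMomentsIsotropy", crux]
def HierarchyClosure : Prop :=
  AngularHierarchy → (let G : ℝ → Literature.Probability.LatticeModels.Site 3 → ℝ := Literature.Probability.LatticeModels.twoPointFree 3; let nE : Literature.Probability.LatticeModels.Site 3 → ℝ := (fun x : Literature.Probability.LatticeModels.Site 3 => Real.sqrt (∑ i, ((x i : ℝ)) ^ 2)); let k : MvPolynomial (Fin 3) ℝ → ℕ → ℝ → ℝ := fun Y m β => ∑' x : Literature.Probability.LatticeModels.Site 3, MvPolynomial.eval (fun i => (x i : ℝ)) Y * nE x ^ (2 * m) * G β x; let M : ℕ → ℝ → ℝ := fun q β => ∑' x : Literature.Probability.LatticeModels.Site 3, nE x ^ q * G β x; let a : MvPolynomial (Fin 3) ℝ → ℕ → ℕ → ℝ → ℝ := fun Y n m β => k Y m β / M (n + 2 * m) β; ∀ (n m : ℕ)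 (Y : MvPolynomial (Fin 3) ℝ), 1 ≤ n → Y.IsHomogeneous n → (∑ i : Fin 3, MvPolynomial.pderiv i (MvPolynomial.pderiv i Y)) = 0 → Filter.Tendsto (fun β => a Y n m β) (nhdsWithin (Literature.Probability.LatticeModels.criticalBeta 3) (Set.Iio (Literature.Probability.LatticeModels.criticalBeta 3))) (nhds 0))

-- `HierarchyClosure` holds: proved by `Summit.CriticalPhenomena.Ising3DConformalLimit.Theorems.hierarchyClosure_proof` (its module imports this route file, so no `_holds` link can be stated here).

/-- item stmt-CriticalPhenomena-6036 · support · rank 9 · open · by planner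
sources: DuminilCopinICM2022, arXiv:2012.11672, Sakai2007, CampostriniEtAl1998, MessagerMiracleSoleJSP1977
[support] [milestone; conclusion of DilutionTransfer, hypothesis of RotationUpgrade] VAGUE
ASYMPTOTIC ISOTROPY of the critical two-point function on ℤ³: for every continuous compactly
supported φ ≥ 0 on ℝ³ with φ ≢ 0 and every R ∈ O(3) (Matrix.orthogonalGroup), Σ_x φ(R
x/L)·⟨σ₀σ_x⟩_(β_c) / Σ_x φ(x/L)·⟨σ₀σ_x⟩_(β_c) → 1 as L → ∞. The lattice, test-function form of the
rotational half of item stmt-CriticalPhenomena-0634 (IsingEuclidUpgradeR2RotInvPowerLaw): no power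
law and no pointwise regularity presupposed; with a pointwise scaling limit it yields S₂(0,Rx) =
S₂(0,x) (Riemann sums + MMS continuity), the continuum milestone
HyperoctahedralRP.TwoPointLimitIsotropic. Open on ℤ³ (rotation invariance only postulated,
DuminilCopinICM2022 §8.1 p.25); planar analogue arXiv:2012.11672; d > 4 via lace expansion
(Sakai2007). [difficulty: open-problem] -/
@[route_item "route-CriticalPhenomena-HarmonicMomentsIsotropy", crux]
def TwoPointAsymptoticIsotropy : Prop :=
  ∀ (φ : (Fin 3 → ℝ) → ℝ), Continuous φ → HasCompactSupport φ → (∀ v, 0 ≤ φ v) → (∃ v, 0 < φ v) → ∀ R : Matrix.orthogonalGroup (Fin 3) ℝ, Filter.Tendsto (fun L : ℝ => (∑' x : Literature.Probability.LatticeModels.Site 3, φ (L⁻¹ • (R.1.mulVec (fun i => (x i : ℝ)))) * Literature.Probability.LatticeModels.criticalTwoPoint 3 x) / (∑' x : Literature.Probability.LatticeModels.Site 3, φ (L⁻¹ • (fun i => (x i : ℝ))) * Literature.Probability.LatticeModels.criticalTwoPoint 3 x)) Filter.atTop (nhds 1)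

/-- item stmt-CriticalPhenomena-6037 · support · rank 9 · closed · proved by Summit.CriticalPhenomena.Ising3DConformalLimit.HarmonicMomentsIsotropyTwoPoint.dilutionTransfer_proof @ ff6d09dde47f (prover) · by planner
sources: DuminilcopinPanis2025, MessagerMiracleSoleJSP1977, Hegerfeldt1977, CampostriniEtAl1998, SteinWeiss1971, AizenmanDuminilCopinAnnals2021
[support] [glue with teeth, Difficulty L] HarmonicDilution → CorrelationLengthWindow →
ExistsScaleCovariantLimit → TwoPointAsymptoticIsotropy (formulas inlined). Proof sketch: ν_β :=
χ(β)⁻¹ Σ_x G_β(x)·δ_(x/ξ₂(β)), probability measures on ℝ³; CLW(ii) ⇒ uniformly bounded exponential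
moments ⇒ tight, subsequential weak limits ν with all moments, moments converge; HarmonicDilution ⇒
∫Y(y)|y|^(2m)dν = lim a_(Y,m)(β)·∫|y|^(n+2m)dν_β = 0 for every harmonic Y of degree ≥ 1 and m ≥ 0,
so by the Fischer decomposition P = Σ_j |y|^(2j)H_j every polynomial has the same ν- and ν̄-integral
(ν̄ = O(3)-average); Carleman (exponential moments) ⇒ ν = ν̄ is O(3)-invariant.
ExistsScaleCovariantLimit ⇒ ρ(δ) regularly varying of index −Δ ∈ [−1,−1/2] and ⟨σ₀σ_x⟩_(β_c) ≍
|x|^(−2Δ)ℓ(|x|) uniformly in x̂ (locally uniform convergence on 1 ≤ |y| ≤ 2, S₂ > 0 continuous by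
MMS + homogeneity), so by Karamata every shell {r₁R < |x| ≤ r₂R} carries a fixed fraction of the
critical mass Σ_(|x|≤AR)⟨σ₀σ_x⟩_(β_c); with CLW(i) (G_β ≥ (1−ε)G_(β_c) inside √s ξ₂) this makes ν
charge every shell inside radius √s. Given φ, R and L → ∞ choose β(L) ↑ β_c with ξ₂(β(L)) = L·r_φ/√s
(ξ₂ continuous, → ∞): both sums in the ratio equa -/
@[route_item "route-CriticalPhenomena-HarmonicMomentsIsotropy", crux]
def DilutionTransfer : Prop :=
  (let G : ℝ → Literature.Probability.LatticeModels.Site 3 → ℝ := Literature.Probability.LatticeModels.twoPointFree 3; let nE : Literature.Probability.LatticeModels.Site 3 → ℝ := (fun x : Literature.Probability.LatticeModels.Site 3 => Real.sqrt (∑ i, ((x i : ℝ)) ^ 2)); let k : MvPolynomial (Fin 3) ℝ → ℕ → ℝ → ℝ := fun Y m β => ∑' x : Literature.Probability.LatticeModels.Site 3, MvPolynomial.eval (fun i => (x i : ℝ)) Y * nE x ^ (2 * m) * G β x; let M : ℕ → ℝ → ℝ := fun q β => ∑' x : Literature.Probability.LatticeModels.Site 3, nE x ^ q * G β x; let a :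 MvPolynomial (Fin 3) ℝ → ℕ → ℕ → ℝ → ℝ := fun Y n m β => k Y m β / M (n + 2 * m) β; ∀ (n m : ℕ) (Y : MvPolynomial (Fin 3) ℝ), 1 ≤ n → Y.IsHomogeneous n → (∑ i : Fin 3, MvPolynomial.pderiv i (MvPolynomial.pderiv i Y)) = 0 → Filter.Tendsto (fun β => a Y n m β) (nhdsWithin (Literature.Probability.LatticeModels.criticalBeta 3) (Set.Iio (Literature.Probability.LatticeModels.criticalBeta 3))) (nhds 0)) → CorrelationLengthWindow → ExistsScaleCovariantLimit → (∀ (φ : (Fin 3 → ℝ) → ℝ), Continuous φ → HasCompactSupport φ → (∀ v, 0 ≤ φ v) → (∃ v, 0 < φ v) → ∀ R : Matrix.orthogonalGroup (Fin 3) ℝ, Filter.Tendsto (fun L : ℝ => (∑' x : Literature.Probability.LatticeModels.Site 3, φ (L⁻¹ • (R.1.mulVec (fun i => (x i : ℝ)))) * Literature.Probability.LatticeModels.criticalTwoPoint 3 x) / (∑' x : Literature.Probability.LatticeModels.Site 3, φ (L⁻¹ • (fun i => (x i : ℝ))) * Literature.Probability.LatticeModels.criticalTwoPoint 3 x)) Filter.atTop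 (nhds 1))

-- `DilutionTransfer` holds: proved by `Summit.CriticalPhenomena.Ising3DConformalLimit.HarmonicMomentsIsotropyTwoPoint.dilutionTransfer_proof` @ ff6d09dde47f (its module imports this route file, so no `_holds` link can be stated here).

/-- item stmt-CriticalPhenomena-6038 · assembly · rank 1 · closed · proved by Summit.CriticalPhenomena.Ising3DConformalLimit.Theorems.harmonicMomentsIsotropy_assembly_proof @ 5b4866c146c4 (prover) · by planner
sources: DuminilCopinICM2022, CampostriniEtAl1998
[assembly] AngularHierarchy → HierarchyClosure → CorrelationLengthWindow → ExistsScaleCovariantLimit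
→ DilutionTransfer → RotationUpgrade → InversionUpgradeNormalised → IsingEuclidUpgradeR4NonGaussian
→ Ising3DConformalLimit. -/
@[route_item "route-CriticalPhenomena-HarmonicMomentsIsotropy", crux]
def Assembly : Prop :=
  AngularHierarchy → HierarchyClosure → CorrelationLengthWindow → ExistsScaleCovariantLimit → DilutionTransfer → RotationUpgrade → InversionUpgradeNormalised → IsingEuclidUpgradeR4NonGaussian → Ising3DConformalLimit

-- `Assembly` holds: proved by `Summit.CriticalPhenomena.Ising3DConformalLimit.Theorems.harmonicMomentsIsotropy_assembly_proof` @ 5b4866c146c4 (its module imports this route file, so no `_holds` link can be stated here).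

/-! D-0027 §2.1 — DECIDING THEOREM (planner-authored via `route open/edit --closes-file`; by operator:999:2941348 2026-08-15T15:23:10Z):
its hypotheses are this route's items and its conclusion the sub-problem Statement (glue_lint), and it elaborates with this file. -/

@[closes "route-CriticalPhenomena-HarmonicMomentsIsotropy"] theorem closes : AngularHierarchy → CorrelationLengthWindow → RotationUpgrade → ExistsScaleCovariantLimit → InversionUpgradeNormalised → IsingEuclidUpgradeR4NonGaussian → HarmonicDilution → HierarchyClosure → TwoPointAsymptoticIsotropy → DilutionTransfer → Assembly → _root_.Ising3DConformalLimit := fun h_AngularHierarchy h_CorrelationLengthWindow h_RotationUpgrade h_ExistsScaleCovariantLimit h_InversionUpgradeNormalised h_IsingEuclidUpgradeR4NonGaussian h_HarmonicDilution h_HierarchyClosure h_TwoPointAsymptoticIsotropy h_DilutionTransfer h_Assembly => h_Assembly h_AngularHierarchy h_HierarchyClosure h_CorrelationLengthWindow h_ExistsScaleCovariantLimit h_DilutionTransfer h_RotationUpgrade h_InversionUpgradeNormalised h_IsingEuclidUpgradeR4NonGaussian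

end Summit.CriticalPhenomena.Ising3DConformalLimit.Theses.HarmonicMomentsIsotropy
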